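import Mathlib
import Literature.Computability.AlgebraicComplexity.NestFreeMatchingPoly
import Literature.Barriers.ValiantsHypothesis.MonotoneGapParseTrees
import Summits.ValiantsHypothesis.ValiantsHypothesis.Theorems.FifoMatchingNNPowersNotCertificates
import HarnessLib

/-!
# SATURATED COFACTORS ARE NOT CERTIFICATES: `2^{n^{1/6}} ≤ L₊(NN_n · h)` for every vertex-homogeneous `h` each of whose
# nest-free perfect matchings carries a monomial of `h` — uniformly in `h`

Route `ValiantsHypothesis/FifoMatching`, helper toward crux stmt-ValiantsHypothesis-21181 (`NNDivisionHard`).  Generalises the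
sibling `FifoMatchingNNPowersNotCertificates.lean` (`h = NN_n^M`) to the following class of cofactors of ARBITRARY degree:

* `h` is VERTEX-HOMOGENEOUS (all monomials have the same vertex weights `δ`; for the crux this is no loss — vertex-potential
  initial forms are free for monotone circuits, the route's torus tier), and
* `h` is **SATURATED**: for every nest-free perfect matching `P` of `[2n]` some monomial `e_P` of `h` is supported on the arcs
  of `P` (`e_P ≤ k · χ_P` for some `k`; multiplicities free).  Examples: `h = 1` (`e_P = 0`: recovers `NNMonotoneExpBound`),
  every power `NN_n^M` (`e_P = M χ_P`), every `Σ_P c_P χ_P^{k}` with all `c_P > 0`, every vertex-homogeneous `h ≥ c · NN_n^M`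
  coefficientwise, products of saturated cofactors.

Results:
* `respects_of_add_le_arcs` — TYPE RIGIDITY in general form: if `α + β = m` with `m` supported on the arcs of a perfect
  matching `P` and `α` has vertex weights `ρ`, then `P` preserves `{ρ ≠ 0}`;
* ★ `one_le_complexity_mul_saturated_of_spread` — the SPREAD LAW: `1 ≤ 4 · L₊(NN_n · h) · (n+1)² · β` for every saturated
  vertex-homogeneous `h`, whenever a probability weighting of the nest-free perfect matchings gives every balanced vertex split
  mass `≤ β` (vertex-typed decomposition `VertexTyped.vertexTypedDecomposition` of `NN_n · h`, whose vertex weights `1 + δ_i`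
  are all positive; capture of `P` by the product containing `χ_P + e_P`; rigidity; union bound);
* ★★ `exp_lower_bound_saturated` — eventually in `n`, `2^{n^{1/6}} ≤ L₊(NN_n · h)` for EVERY saturated vertex-homogeneous
  `h` (abstract engine `SpreadLaw.exp_lower_bound_of_spreadLaw` at `F n = min_h L₊(NN_n · h)` over the class);
* ★★ `saturated_not_certificate_qp` — in the currency of the crux: `∀ c`, eventually, `2^((log₂ n + c)^c) < L₊(NN_n·h) + L₊(h)`
  for every saturated vertex-homogeneous `h` — this sub-class of the HYPER-DEGREE residual of 21181 is closed.

HONEST FRAMING: a support-based (Jerrum–Snir) rung; the open residual of stmt-21181 is thereby the vertex-homogeneous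
cofactors that MISS some nest-free perfect matching (no monomial inside it) — still containing all the interesting sparse /
structured `h`; 21181 stays OPEN; nothing here bears on `NNNotVP` or VP ≠ VNP (NOT proved).

References: M. Jerrum, M. Snir, J. ACM 29 (1982) §3, §4.3 [JerrumSnir1982]; P. Hrubeš, A. Yehudayoff, *Shadows of Newton
polytopes*, CCC 2021, §6 Problem 2 [HrubesYehudayoff2021].
-/

noncomputable section

-- Sub = Summit single-conjunct layout: the duplicated namespace component is mandated by the tree.
set_option linter.dupNamespace false

namespace Summit.ValiantsHypothesis.ValiantsHypothesis.Theorems.FifoMatching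

namespace SaturatedCofactor

open Finset MvPolynomial Literature.Computability.AlgebraicComplexity
open Literature.Barriers.ValiantsHypothesis
open Summit.ValiantsHypothesis.ValiantsHypothesis.Theorems.FifoMatching.NNPowers
  (vweight_arcExponent exists_of_mem_support_nn)
open scoped NNReal BigOperators

variable {m : ℕ}

/-! ### §1 Type rigidity for arc-supported monomials -/

/-- **TYPE RIGIDITY (general form).**  If `α + β = m` where `m` is supported on the arcs of a perfect matching `P`
(`m a ≠ 0 → χ_P a ≠ 0`) and `α` has vertex weights `ρ`, then `P` preserves the vertex split `{i | ρ i ≠ 0}`. [folklore] -/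
theorem respects_of_add_le_arcs {P : Fin m → Fin m} (hP : P ∈ perfectMatchings m)
    {mP α β : (Fin m × Fin m) →₀ ℕ} (hm : ∀ a, mP a ≠ 0 → arcExponent P a ≠ 0) (h : α + β = mP)
    {ρ : Fin m → ℕ} (hρ : ∀ i, ∑ j, (α (i, j) + α (j, i)) = ρ i) :
    ∀ i, ρ i ≠ 0 ↔ ρ (P i) ≠ 0 := by
  obtain ⟨hinv, -⟩ := mem_perfectMatchings.1 hP
  have hle : ∀ i j, α (i, j) ≠ 0 → i < P i ∧ P i = j := by
    intro i j hij
    have h1 : mP (i, j) ≠ 0 := by rw [← h]; simp only [Finsupp.coe_add, Pi.add_apply]; omega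
    have h2 := hm _ h1
    rw [arcExponent_apply] at h2
    by_contra hc
    exact h2 (if_neg hc)
  have key : ∀ i, ρ i ≠ 0 ↔ α (i, P i) ≠ 0 ∨ α (P i, i) ≠ 0 := by
    intro i
    rw [← hρ i]
    constructor
    · intro hs
      obtain ⟨j, -, hj⟩ := Finset.exists_ne_zero_of_sum_ne_zero hs
      by_cases h1 : α (i, j) ≠ 0
      · exact Or.inl (by rw [← (hle i j h1).2] at h1; exact h1)
      · have h2 : α (j, i) ≠ 0 := by omega
        have hji := (hle j i h2).2
        have : j = P i := by rw [← hji, hinv]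
        subst this
        exact Or.inr h2
    · intro hor hs
      have hterm := Finset.sum_eq_zero_iff.mp hs (P i) (Finset.mem_univ _)
      rcases hor with h1 | h2 <;> omega
  intro i
  rw [key i, key (P i), hinv]
  exact Or.comm

/-! ### §2 The spread law for saturated vertex-homogeneous cofactors -/

/-- ★ **THE SPREAD LAW FOR SATURATED COFACTORS.**  Let `n ≥ 3`, `μ` a probability weighting of the nest-free perfect
matchings of `[2n]` giving every balanced vertex split (`2n < 3|S| ≤ 4n`) mass `≤ β`, and `h` a cofactor over `ℝ≥0` that is
vertex-homogeneous (weights `δ`) and SATURATED (every nest-free perfect matching carries a monomial of `h`).  Then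
`1 ≤ 4 · L₊(NN_n · h) · (n+1)² · β`. [cite: JerrumSnir1982, §3 (Thm. 3.2) and §4.3] -/
theorem one_le_complexity_mul_saturated_of_spread {n : ℕ} (hn : 3 ≤ n) {β : ℝ≥0}
    (μ : (Fin (2 * n) → Fin (2 * n)) → ℝ≥0) (hμ : ∑ P ∈ nestFreeMatchings (2 * n), μ P = 1)
    (hβ : ∀ S : Finset (Fin (2 * n)), 2 * n < 3 * S.card → 3 * S.card ≤ 4 * n →
      (∑ P ∈ (nestFreeMatchings (2 * n)).filter (fun P => ∀ i, i ∈ S ↔ P i ∈ S), μ P) ≤ β)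
    (h : MvPolynomial (Fin (2 * n) × Fin (2 * n)) ℝ≥0) (δ : Fin (2 * n) → ℕ)
    (hδ : ∀ e ∈ h.support, ∀ i, ∑ j, (e (i, j) + e (j, i)) = δ i)
    (hsat : ∀ P ∈ nestFreeMatchings (2 * n), ∃ e ∈ h.support, ∀ a, e a ≠ 0 → arcExponent P a ≠ 0) :
    (1 : ℝ) ≤ 4 * (complexity (nestFreeMatchingPoly n ℝ≥0 * h) : ℝ) * ((n : ℝ) + 1) ^ 2 * (β : ℝ) := by
  classical
  set g := nestFreeMatchingPoly n ℝ≥0 * h with hg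
  -- `g` is vertex-homogeneous with positive weights `1 + δ`
  have hgw : ∀ e ∈ g.support, ∀ i, ∑ j, (e (i, j) + e (j, i)) = 1 + δ i := by
    intro e he i
    obtain ⟨a, ha, b, hb, rfl⟩ := Finset.mem_add.1 (support_mul _ _ he)
    obtain ⟨P, hP, rfl⟩ := exists_of_mem_support_nn ha
    have h1 := vweight_arcExponent (nestFreeMatchings_subset_perfectMatchings hP) i
    have h2 := hδ b hb i
    simp only [Finsupp.coe_add, Pi.add_apply, Finset.sum_add_distrib] at h1 h2 ⊢
    omega
  obtain ⟨s, hs, a, b, hsum, htyp⟩ := VertexTyped.vertexTypedDecomposition (N := 2 * n) (by omega) g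
    (fun i => 1 + δ i) hgw (fun _ => by omega)
  choose ρ hρ hlo hhi using htyp
  -- capture
  have hcap : ∀ P ∈ nestFreeMatchings (2 * n),
      ∃ t : Fin s, ∀ i, i ∈ (Finset.univ.filter fun i => ρ t i ≠ 0) ↔
        P i ∈ (Finset.univ.filter fun i => ρ t i ≠ 0) := by
    intro P hP
    obtain ⟨e, he, hearcs⟩ := hsat P hP
    have hPsupp : arcExponent P ∈ (nestFreeMatchingPoly n ℝ≥0).support := by
      rw [nestFreeMatchingPoly_eq_sum_arcMonomial,
        support_sum_arcMonomial nestFreeMatchings_subset_perfectMatchings]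
      exact Finset.mem_image_of_mem _ hP
    have hmem : arcExponent P + e ∈ g.support := by
      rw [hg, JerrumSnir.support_mul_eq]; exact Finset.add_mem_add hPsupp he
    rw [hsum] at hmem
    obtain ⟨t, -, ht⟩ := Finset.mem_biUnion.1 (support_sum hmem)
    rw [JerrumSnir.support_mul_eq] at ht
    obtain ⟨α, hα, β', -, hαβ⟩ := Finset.mem_add.1 ht
    have harcs : ∀ c, (arcExponent P + e) c ≠ 0 → arcExponent P c ≠ 0 := by
      intro c hc
      simp only [Finsupp.coe_add, Pi.add_apply] at hc
      by_cases h1 : arcExponent P c ≠ 0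
      · exact h1
      · exact hearcs c (by omega)
    refine ⟨t, fun i => ?_⟩
    simp only [Finset.mem_filter, Finset.mem_univ, true_and]
    exact respects_of_add_le_arcs (nestFreeMatchings_subset_perfectMatchings hP) harcs hαβ (hρ t α hα) i
  -- union bound
  have hE : ∀ t : Fin s,
      (∑ P ∈ (nestFreeMatchings (2 * n)).filter
        (fun P => ∀ i, i ∈ (Finset.univ.filter fun i => ρ t i ≠ 0) ↔
          P i ∈ (Finset.univ.filter fun i => ρ t i ≠ 0)), μ P) ≤ β :=
    fun t => hβ _ (hlo t) (by have := hhi t; omega)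
  have h1 : (1 : ℝ≥0) ≤ (s : ℝ≥0) * β := by
    calc (1 : ℝ≥0) = ∑ P ∈ nestFreeMatchings (2 * n), μ P := hμ.symm
      _ ≤ ∑ P ∈ nestFreeMatchings (2 * n), ∑ t : Fin s,
            (if (∀ i, i ∈ (Finset.univ.filter fun i => ρ t i ≠ 0) ↔
                P i ∈ (Finset.univ.filter fun i => ρ t i ≠ 0)) then μ P else 0) := by
          refine Finset.sum_le_sum fun P hP => ?_
          obtain ⟨t, ht⟩ := hcap P hP
          refine le_trans ?_ (Finset.single_le_sum (f := fun t : Fin s =>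
            if (∀ i, i ∈ (Finset.univ.filter fun i => ρ t i ≠ 0) ↔
                P i ∈ (Finset.univ.filter fun i => ρ t i ≠ 0)) then μ P else 0)
            (fun _ _ => zero_le) (Finset.mem_univ t))
          simp only [if_pos ht, le_refl]
      _ = ∑ t : Fin s, ∑ P ∈ nestFreeMatchings (2 * n),
            (if (∀ i, i ∈ (Finset.univ.filter fun i => ρ t i ≠ 0) ↔
                P i ∈ (Finset.univ.filter fun i => ρ t i ≠ 0)) then μ P else 0) := Finset.sum_comm
      _ = ∑ t : Fin s, (∑ P ∈ (nestFreeMatchings (2 * n)).filter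
            (fun P => ∀ i, i ∈ (Finset.univ.filter fun i => ρ t i ≠ 0) ↔
              P i ∈ (Finset.univ.filter fun i => ρ t i ≠ 0)), μ P) := by
          refine Finset.sum_congr rfl fun t _ => ?_
          rw [Finset.sum_filter]
      _ ≤ ∑ _t : Fin s, β := Finset.sum_le_sum fun t _ => hE t
      _ = (s : ℝ≥0) * β := by simp
  have h1' : (1 : ℝ) ≤ (s : ℝ) * (β : ℝ) := by exact_mod_cast h1
  have hsL : (s : ℝ) ≤ (complexity g : ℝ) := by exact_mod_cast hs
  have hβ0 : (0 : ℝ) ≤ β := β.coe_nonneg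
  have hn1 : (1 : ℝ) ≤ ((n : ℝ) + 1) ^ 2 := by
    have : (1 : ℝ) ≤ (n : ℝ) + 1 := by
      have : (0 : ℝ) ≤ n := Nat.cast_nonneg n
      linarith
    nlinarith
  calc (1 : ℝ) ≤ (s : ℝ) * β := h1'
    _ ≤ (complexity g : ℝ) * β := mul_le_mul_of_nonneg_right hsL hβ0
    _ = 1 * (complexity g : ℝ) * 1 * β := by ring
    _ ≤ 4 * (complexity g : ℝ) * ((n : ℝ) + 1) ^ 2 * β := by
        gcongr
        norm_num

/-! ### §3 The exponential bound, uniformly over the class, and the certificate reading -/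

/-- ★★ **SATURATED VERTEX-HOMOGENEOUS COFACTORS ARE EXPONENTIALLY EXPENSIVE, UNIFORMLY**: there is `n₀` such that for all
`n ≥ n₀` and EVERY vertex-homogeneous saturated `h`, `2^{n^{1/6}} ≤ L₊(NN_n · h)` (the abstract thick-queue engine at
`F n =` the least `L₊(NN_n · h)` over the class, inhabited by `h = 1`). [cite: JerrumSnir1982, §4.3] -/
theorem exp_lower_bound_saturated : ∃ n₀ : ℕ, ∀ n : ℕ, n₀ ≤ n →
    ∀ (h : MvPolynomial (Fin (2 * n) × Fin (2 * n)) ℝ≥0) (δ : Fin (2 * n) → ℕ),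
      (∀ e ∈ h.support, ∀ i, ∑ j, (e (i, j) + e (j, i)) = δ i) →
      (∀ P ∈ nestFreeMatchings (2 * n), ∃ e ∈ h.support, ∀ a, e a ≠ 0 → arcExponent P a ≠ 0) →
        (2 : ℝ) ^ ((n : ℝ) ^ ((1 : ℝ) / 6)) ≤ (complexity (nestFreeMatchingPoly n ℝ≥0 * h) : ℝ) := by
  classical
  -- the class and its least certificate cost
  let good : (n : ℕ) → Set ℕ := fun n => {L | ∃ (h : MvPolynomial (Fin (2 * n) × Fin (2 * n)) ℝ≥0)
    (δ : Fin (2 * n) → ℕ), (∀ e ∈ h.support, ∀ i, ∑ j, (e (i, j) + e (j, i)) = δ i) ∧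
      (∀ P ∈ nestFreeMatchings (2 * n), ∃ e ∈ h.support, ∀ a, e a ≠ 0 → arcExponent P a ≠ 0) ∧
      L = complexity (nestFreeMatchingPoly n ℝ≥0 * h)}
  have hone : ∀ n, complexity (nestFreeMatchingPoly n ℝ≥0 * 1) ∈ good n := by
    intro n
    refine ⟨1, fun _ => 0, fun e he i => ?_, fun P _ => ⟨0, ?_, fun a ha => absurd rfl ha⟩, rfl⟩
    · have : e = 0 := by
        rw [support_one] at he
        simpa using he
      subst this; simp
    · rw [mem_support_iff, coeff_one, if_pos rfl]; exact one_ne_zero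
  set F : ℕ → ℕ := fun n => sInf (good n) with hF
  have hmem : ∀ n, F n ∈ good n := fun n => Nat.sInf_mem ⟨_, hone n⟩
  obtain ⟨n₀, hn₀⟩ := SpreadLaw.exp_lower_bound_of_spreadLaw F (fun n hn β μ hμ hS => by
    obtain ⟨h, δ, hδ, hsat, hL⟩ := hmem n
    rw [hL]
    exact one_le_complexity_mul_saturated_of_spread hn μ hμ hS h δ hδ hsat)
  refine ⟨n₀, fun n hn h δ hδ hsat => ?_⟩
  have hle : F n ≤ complexity (nestFreeMatchingPoly n ℝ≥0 * h) := Nat.sInf_le ⟨h, δ, hδ, hsat, rfl⟩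
  exact (hn₀ n hn).trans (by exact_mod_cast hle)

/-- ★★ **SATURATED COFACTORS ARE NOT CERTIFICATES (currency of stmt-21181)**: for every `c`, eventually in `n`,
`2^((log₂ n + c)^c) < L₊(NN_n · h) + L₊(h)` for EVERY vertex-homogeneous saturated cofactor `h` (any degree).
[cite: JerrumSnir1982, §4.3] [cite: HrubesYehudayoff2021, §6 Problem 2] -/
theorem saturated_not_certificate_qp (c : ℕ) : ∃ n₀ : ℕ, ∀ n : ℕ, n₀ ≤ n →
    ∀ (h : MvPolynomial (Fin (2 * n) × Fin (2 * n)) ℝ≥0) (δ : Fin (2 * n) → ℕ),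
      (∀ e ∈ h.support, ∀ i, ∑ j, (e (i, j) + e (j, i)) = δ i) →
      (∀ P ∈ nestFreeMatchings (2 * n), ∃ e ∈ h.support, ∀ a, e a ≠ 0 → arcExponent P a ≠ 0) →
        2 ^ ((Nat.log 2 n + c) ^ c) <
          complexity (nestFreeMatchingPoly n ℝ≥0 * h) + complexity h := by
  obtain ⟨n₁, hn₁⟩ := exp_lower_bound_saturated
  obtain ⟨n₂, hn₂⟩ := CorSandwich.polylog_lt_rpow_eventually c (c := 1 / 6) (by norm_num)
  refine ⟨max n₁ n₂, fun n hn h δ hδ hsat => ?_⟩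
  have h1 := hn₁ n (le_of_max_le_left hn) h δ hδ hsat
  have h2 := hn₂ n (le_of_max_le_right hn)
  have h3 : (2 : ℝ) ^ (((Nat.log 2 n + c) ^ c : ℕ) : ℝ) < (2 : ℝ) ^ ((n : ℝ) ^ ((1 : ℝ) / 6)) :=
    Real.rpow_lt_rpow_of_exponent_lt (by norm_num) h2
  have h4 : ((2 ^ ((Nat.log 2 n + c) ^ c) : ℕ) : ℝ) <
      ((complexity (nestFreeMatchingPoly n ℝ≥0 * h) : ℕ) : ℝ) := by
    rw [Nat.cast_pow, Nat.cast_ofNat, ← Real.rpow_natCast]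
    exact h3.trans_le h1
  have h5 : 2 ^ ((Nat.log 2 n + c) ^ c) < complexity (nestFreeMatchingPoly n ℝ≥0 * h) := by exact_mod_cast h4
  exact Nat.lt_add_right _ h5

end SaturatedCofactor

end Summit.ValiantsHypothesis.ValiantsHypothesis.Theorems.FifoMatching

end
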